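import Literature.NumberTheory.EllipticCurves.BSDSelmerSmithCaseIICoefficientsProofs
import Literature.NumberTheory.EllipticCurves.BSDSelmerSmithNoRationalTwoTorsionCMProofs
import Literature.NumberTheory.EllipticCurves.BSDSelmerSmithCasesExplicitProofs
import Literature.NumberTheory.EllipticCurves.BSDSelmerSmithRootNumberDensityProofs
import Literature.NumberTheory.EllipticCurves.BSDSelmerSmithIsogenyProofs
import HarnessLib

/-!
# Smith's `2^∞`-Selmer corank law for the CM elliptic curves over `ℚ` from the refereed
# parts I–II of Smith: the `j`-invariant table (`j = 0`, `54000`, `1728`, `287496`; `j = 8000` excluded)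

A `…Proofs` companion (theorems only; no definitions, no named facts, no axioms) of
`BSDSelmerSmithCaseIICoefficientsProofs` (the decidable Case II criterion
`smithCaseII_of_not_isSquare`: `y² = x(x² + ax + b)` is in Smith's Case II iff `a² - 4b`, `b`,
`b(a² - 4b)` are non-squares — [Smi22b] Ex. 1.2), `BSDSelmerSmithCasesExplicitProofs`
(`smithCaseI_iff_of_roots`: `y² = x(x - r)(x - s)` is in Case I iff `rs`, `r(r - s)`, `s(s - r)`
are non-squares), `BSDSelmerSmithNoRationalTwoTorsionCMProofs` (branch (1) of [Smi22a]
Assumption 1.1 for `y² = x³ + k` with `-k ∉ ℚ³`) and of the cell `bsd-goldfeld`'s file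
`Summits/…/GoldfeldGoodTwistsSmithCaseII` (the `j = -3375`, `16581375` classes).

The source theorem is **[Smi22a] = A. Smith, *The distribution of `ℓ^∞`-Selmer groups in degree
`ℓ` twist families I*, J. Amer. Math. Soc. 39 (2026) 1–72, Thm. 1.2** under its Assumption 1.1
(three admissible rational `2`-torsion structures), the tree's named fact
`smith2022_selmerCorank_distribution` (`h22`); branch (2) of Assumption 1.1 is proved in
**[Smi22b]**, J. Amer. Math. Soc. 39 (2026) 453–514, §1 ("This proves the second case of
[Smi1, Theorem 1.2]"). For a curve `E/ℚ` in Smith's Case I or Case II (arXiv:2503.17619,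
Def. 1.6; `smi22aAssumption_iff_smithCaseI_or_smithCaseII`) the `1/2, 1/2, 0` law for the
`2^∞`-Selmer coranks of the quadratic twists `E^d` — the tree's `smith_selmerCorank_density E` —
therefore follows from REFEREED print, with no appeal to the 2025 preprint arXiv:2503.17619
(whose Thm. 1.7 is needed exactly for the curves having a *balanced* `2`-isogeny — Cases IV and V
of Def. 1.6 — and, through the isogeny invariance of the law, for those Case III curves whose
`2`-isogenous curve with full rational `2`-torsion is itself in Case IV or V: arXiv:2503.17619
§1.1, p. 3, "If `E` is in Case I or Case II, Theorem 1.1 follows for `E` from [Smi22a]. The main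
goal of this paper is to establish this theorem for Cases IV and V" and, after Thm. 1.7, "if `E`
is in Case III, there is a `ℚ` isogeny `φ : E → E₀` to a curve `E₀` in either Case I, IV, or V";
the Case III curves of THIS file, §§3–4 below, are `2`-isogenous to Case I curves and need only
[Smi22a]).

This file completes the table of the thirteen CM `j`-invariants over `ℚ` for this question
(and formalises the three "routine checks, not formalised here" of
`Kriz2020/GoldfeldJ1728Proofs` — `ℤ[i]` branch (2), `ℤ[2i]`, `ℤ[√-2]`):

* §0 transport helpers: Case II is invariant under change of Weierstrass model
  (`smithCaseII_smul`); Smith's law for every curve with a given `j ∉ {0, 1728}` from Smith's law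
  for all quadratic twists of one model (`smith_selmerCorank_density_of_j_eq_of_forall_quadraticTwist`,
  Silverman *AEC* X.5.4).
* §1 **`j = 0` (CM by `ℤ[ζ₃]`), every curve**: `W ≅ y² = x³ + k`; if `k = c³` the curve is
  `y² = x(x² - 3cx + 3c²)` (shift `x ↦ x - c`), which is in Case II (`a² - 4b = -3c²`,
  `b = 3c²`, `b(a² - 4b) = -9c⁴`); otherwise `E(ℚ)[2] = 0` (branch (1), file
  `BSDSelmerSmithNoRationalTwoTorsionCMProofs`). Hence `smith_selmerCorank_density W` for EVERY
  elliptic `W/ℚ` with `j = 0` from `h22` (`smith_selmerCorank_density_of_j_eq_zero_of_smith2022`).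
* §2 **`j = 54000 = 2⁴·3³·5³` (CM by `ℤ[√-3]`, the order of conductor `2`)**: the twists
  `y² = x(x² + 6dx - 3d²)` are in Case II (`a² - 4b = 48d² = 3·(4d)²`, `b = -3d²`,
  `b(a² - 4b) = -144d⁴`); every curve with `j = 54000`
  (`smith_selmerCorank_density_of_j_eq_54000_of_smith2022`).
* §3 **`j = 1728` (CM by `ℤ[i]`), every curve**: `W ≅ y² = x³ + Ax`, `A ≠ 0`; if `A, -A ∉ ℚ²`
  the curve is in Case II (`a² - 4b = -4A`, `b = A`, `b(a² - 4b) = -4A²`); if `A = -c²` it is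
  `y² = x(x - c)(x + c)` in Case I (`rs = -c²`, `r(r - s) = s(s - r) = 2c²`: the congruent number
  twists, branch (3)); if `A = c²` it is in Case III but `2`-isogenous to
  `y² = x³ - 4c²x` (Case I), and Smith's law is an isogeny invariant
  (`smith_selmerCorank_density_of_isogeny`, arXiv:2503.17619 §1.1). Hence
  `smith_selmerCorank_density_of_j_eq_1728_of_smith2022` for EVERY elliptic `W/ℚ` with `j = 1728`.
* §4 **`j = 287496 = 66³` (CM by `ℤ[2i]`)**: the twists `y² = x(x² - 6dx + d²)` of the tree's
  `E₁₆` are in Case III (`b = d²`), `2`-isogenous to `y² = x(x + 4d)(x + 8d)` (Case I: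
  `rs = 2(4d)²`, `r(r - s) = -16d²`, `s(s - r) = 2(4d)²`); every curve with `j = 287496`
  (`smith_selmerCorank_density_of_j_eq_287496_of_smith2022`).
* §5 **`j = 8000 = 20³` (CM by `ℤ[√-2]`) is the one CM class NOT covered by [Smi22a]**: the
  twists `y² = x(x² + 4dx + 2d²)` have `E(ℚ)[2] ≅ ℤ/2ℤ` and `b(a² - 4b) = 16d⁴ ∈ ℚ²`, i.e. the
  `2`-isogeny is balanced (`ℚ(E[2]) = ℚ(√2) = ℚ(E₀[2])`): they are in neither Case I nor Case II,
  so [Smi22a] Assumption 1.1 FAILS for every curve with `j = 8000`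
  (`not_smi22aAssumption_of_j_eq_8000`); for these Smith's law is the tree's assembly
  `smith_selmerCorank_density_holds_of` from arXiv:2503.17619 Thm. 1.17 (preprint) + Monsky +
  Modularity.

Together with `smith_selmerCorank_density_of_j_eq_neg3375 / _16581375` (cell file 6) and
`smith_selmerCorank_density_of_j_mem_of_smith2022`, `…_of_j_eq_neg12288000_of_smith2022`
(`BSDSelmerSmithNoRationalTwoTorsionCMProofs`): **for every CM elliptic curve `E/ℚ` with
`j(E) ≠ 8000`, Smith's `1/2, 1/2, 0` law for the `2^∞`-Selmer coranks of its quadratic twists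
follows from the refereed [Smi22a]+[Smi22b] alone**; with Burungale–Tian (Ann. of Math. 203
(2026), Thm. 1.1: rank-zero `p`-converse for CM curves, any `p`) and Gross–Zagier–Kolyvagin this is
the input of the even-parity Goldfeld statement `twistDensity_rankZero_bsd_of_hasCM` of the cell
`bsd-goldfeld` for all these families.

## References

* [Smith2022SelmerTwistI] A. Smith, J. Amer. Math. Soc. 39 (2026) 1–72 (arXiv:2207.05674):
  Assumption 1.1, Thm. 1.2, Thm. 1.5.
* [Smith2026SelmerTwistII] A. Smith, J. Amer. Math. Soc. 39 (2026) 453–514 (arXiv:2207.05143):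
  §1 Example 1.2, Thm. 1.4 and the paragraph after it.
* [SmithGoldfeld2025] A. Smith, arXiv:2503.17619 (2025): Def. 1.6 (Cases I–V), §1.1 (Case III
  reduction; "If `E` is in Case I or Case II, Theorem 1.1 follows for `E` from [Smi22a]"),
  Prop. 1.18.
* [SilvermanAEC2009] J. H. Silverman, *AEC*, 2nd ed.: III.1 (change of variables), X.5.4 and
  Cor. X.5.4.1 (twists of `j ≠ 0, 1728`; of `j = 0`: `y² = x³ + k`; of `j = 1728`: `y² = x³ + Ax`),
  App. A §3 (the thirteen CM `j`-invariants over `ℚ`).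
* [SilvermanATAEC1994] J. H. Silverman, *Advanced Topics*, App. A §3 (table of CM curves / `ℚ`).
-/

noncomputable section

open scoped Classical

namespace Literature.NumberTheory.EllipticCurves

open WeierstrassCurve

/-! ## §0 Transport helpers -/

section Transport

/-- **Case II is a property of the elliptic curve, not of the model**: if `E` is in Smith's
Case II then so is `C • E` for every admissible change of variables `C` (`#E(ℚ)[2]`,
`ker ρ̄_{E,2}` and isogenies with their degrees are transported along the `ℚ`-isomorphism
`E ≅ C • E`; Silverman, *AEC*, III.3.1(b)). [cite: SmithGoldfeld2025, Def. 1.6]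
[cite: SilvermanAEC2009, III.3.1(b)] -/
theorem smithCaseII_smul {E : WeierstrassCurve ℚ} [E.IsElliptic] (C : VariableChange ℚ)
    (h : smithCaseII E) : smithCaseII (C • E) := by
  obtain ⟨h2, W₀, hW₀, φ, hφ, hnb, hc⟩ := h
  obtain ⟨φ', hφ'⟩ := Isogeny.exists_comp_toIsogeny φ C
  refine ⟨(ratTwoTorsionCard_smul _ _).trans h2, W₀, hW₀, φ',
    (Isogeny.degree_eq_of_comp_toIsogeny hφ').trans hφ, fun hb' ↦ ?_, hc⟩
  exact hnb ⟨hφ, (ker_galoisRepTorsion_smul _ _ 2).symm.trans hb'.2⟩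

/-- **Smith's law along a `j`-class, `j ∉ {0, 1728}`.** If Smith's `1/2, 1/2, 0` law holds for
every quadratic twist `E^{(d)}` (`d ≠ 0`) of one elliptic curve `E/ℚ` with `j(E) ≠ 0, 1728`, it
holds for every elliptic `W/ℚ` with `j(W) = j(E)`: such a `W` is `ℚ`-isomorphic to some `E^{(d)}`
(Silverman, *AEC*, X.5.4; tree `exists_variableChange_eq_quadraticTwist_of_j_eq'`) and the law
does not depend on the model (`smith_selmerCorank_density_smul_iff`).
[cite: SilvermanAEC2009, X.5 Prop. 5.4] [cite: SmithGoldfeld2025, Thm. 1.1] -/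
theorem smith_selmerCorank_density_of_j_eq_of_forall_quadraticTwist {E : WeierstrassCurve ℚ}
    [E.IsElliptic] (h0 : E.j ≠ 0) (h1728 : E.j ≠ 1728)
    (hE : ∀ d : ℚ, d ≠ 0 → smith_selmerCorank_density (E.quadraticTwist d))
    (W : WeierstrassCurve ℚ) [W.IsElliptic] (hj : W.j = E.j) : smith_selmerCorank_density W := by
  obtain ⟨d, hd, C, hC⟩ := exists_variableChange_eq_quadraticTwist_of_j_eq' (W := W) (E := E) hj
    (by rw [hj]; exact h0) (by rw [hj]; exact h1728)
  have h := hE d hd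
  rw [← hC] at h
  exact (smith_selmerCorank_density_smul_iff W C).mp h

end Transport

/-! ## §1 `j = 0`: every `y² = x³ + k` -/

section JZero

/-- **Curves with `j = 0` are `y² = x³ + k`, `k ≠ 0`, up to `ℚ`-isomorphism**: on a short model
`y² = x³ + a₄x + a₆` (`exists_variableChange_isShortNF`), `j = 0` forces `c₄ = -48a₄ = 0`, and
then `Δ = -432a₆² ≠ 0` (Silverman, *AEC*, X.5.4(ii): the twists of `j = 0` are the
`y² = x³ + k`, `k ∈ ℚ*/ℚ*⁶`). [cite: SilvermanAEC2009, X.5 Prop. 5.4 (ii)] -/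
theorem exists_variableChange_eq_j_zero_model (W : WeierstrassCurve ℚ) [W.IsElliptic]
    (hj : W.j = 0) : ∃ (C : VariableChange ℚ) (k : ℚ), k ≠ 0 ∧ C • W = ⟨0, 0, 0, 0, k⟩ := by
  haveI : Invertible (2 : ℚ) := invertibleOfNonzero two_ne_zero
  haveI : Invertible (3 : ℚ) := invertibleOfNonzero three_ne_zero
  obtain ⟨C, hC⟩ := W.exists_variableChange_isShortNF
  haveI := hC
  have hjS : (C • W).j = 0 := by rw [variableChange_j]; exact hj
  have hc₄ : (C • W).c₄ = 0 := by
    rw [j] at hjS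
    rcases mul_eq_zero.mp hjS with h | h
    · exact absurd h (Units.ne_zero _)
    · exact (pow_eq_zero_iff (by norm_num)).mp h
  have ha₄ : (C • W).a₄ = 0 := by
    have h := (C • W).c₄_of_isShortNF
    rw [hc₄] at h
    linarith
  have ha₆ : (C • W).a₆ ≠ 0 := by
    intro h6
    have hΔ : ((C • W).Δ' : ℚ) ≠ 0 := (C • W).Δ'.ne_zero
    rw [coe_Δ', Δ_of_isShortNF, ha₄, h6] at hΔ
    norm_num at hΔ
  refine ⟨C, (C • W).a₆, ha₆, ?_⟩
  ext
  · exact a₁_of_isShortNF _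
  · exact a₂_of_isShortNF _
  · exact a₃_of_isShortNF _
  · exact ha₄
  · rfl

/-- The shift `x ↦ x - c` (`(u, r, s, t) = (1, -c, 0, 0)`) carries `y² = x³ + c³` to the
two-torsion normal form `y² = x³ - 3cx² + 3c²x = x(x² - 3cx + 3c²)` (the rational `2`-torsion
point `(-c, 0)` goes to `(0, 0)`). [cite: SilvermanAEC2009, III.1 (Table 3.1)] -/
theorem smul_j_zero_model_cube (c : ℚ) :
    (⟨1, -c, 0, 0⟩ : VariableChange ℚ) • (⟨0, 0, 0, 0, c ^ 3⟩ : WeierstrassCurve ℚ) =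
      ⟨0, -(3 * c), 0, 3 * c ^ 2, 0⟩ := by
  ext <;> simp only [variableChange_a₁, variableChange_a₂, variableChange_a₃, variableChange_a₄,
    variableChange_a₆, inv_one, Units.val_one] <;> ring

/-- **`y² = x(x² - 3cx + 3c²)` (`≅ y² = x³ + c³`, `c ≠ 0`) is in Smith's Case II**:
`a² - 4b = -3c² < 0`, `b = 3c² = 3·c²` with `3 ∉ ℚ²`, `b(a² - 4b) = -9c⁴ < 0` are non-squares,
i.e. `E(ℚ)[2] ≅ ℤ/2ℤ`, `ℚ(E[2]) = ℚ(√-3) ≠ ℚ(√3) = ℚ(E₀[2])` and `E₀(ℚ)[2] ≇ (ℤ/2ℤ)²`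
([Smi22b], Ex. 1.2 / Thm. 1.4: `K = ℚ(√-3)`, `K₀ = ℚ(√3)` distinct nontrivial).
[cite: Smith2026SelmerTwistII, §1 Example 1.2 and Thm. 1.4] [cite: SmithGoldfeld2025, Def. 1.6] -/
theorem smithCaseII_jZero_twoTorsionNF (c : ℚ) (hc : c ≠ 0) :
    smithCaseII (⟨0, -(3 * c), 0, 3 * c ^ 2, 0⟩ : WeierstrassCurve ℚ) := by
  have hc2 : 0 < c ^ 2 := by positivity
  refine smithCaseII_of_not_isSquare (-(3 * c)) (3 * c ^ 2) ?_ ?_ ?_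
  · rintro ⟨r, hr⟩
    nlinarith [mul_self_nonneg r]
  · rintro ⟨r, hr⟩
    have h3 : IsSquare (3 : ℚ) := ⟨r / c, by
      rw [div_mul_div_comm, eq_div_iff (mul_ne_zero hc hc)]
      linear_combination hr⟩
    norm_num at h3
  · rintro ⟨r, hr⟩
    nlinarith [mul_self_nonneg r, pow_pos hc2 2]

/-- `y² = x(x² - 3cx + 3c²)` is elliptic for `c ≠ 0` (`Δ = 16·b²·(a² - 4b) = -432c⁶`).
[cite: SilvermanAEC2009, III.1 (formulas for `b₂, b₄, b₆, b₈, Δ`) and Prop. III.1.4 (a)] -/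
theorem isElliptic_jZero_twoTorsionNF (c : ℚ) (hc : c ≠ 0) :
    (⟨0, -(3 * c), 0, 3 * c ^ 2, 0⟩ : WeierstrassCurve ℚ).IsElliptic :=
  isElliptic_mk_of_ne (-(3 * c)) (3 * c ^ 2)
    (by
      rw [show (-(3 * c)) ^ 2 - 4 * (3 * c ^ 2) = -3 * c ^ 2 by ring]
      exact mul_ne_zero (by norm_num) (pow_ne_zero 2 hc))
    (mul_ne_zero three_ne_zero (pow_ne_zero 2 hc))

/-- **Smith's law for `y² = x(x² - 3cx + 3c²)`, `c ≠ 0`, from [Smi22a] Thm. 1.2**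
(Case II ⟹ Assumption 1.1 (2)). [cite: Smith2022SelmerTwistI, Thm. 1.2 with Assumption 1.1 (2)]
[cite: Smith2026SelmerTwistII, §1 Example 1.2] -/
theorem smith_selmerCorank_density_jZero_twoTorsionNF (h22 : smith2022_selmerCorank_distribution)
    (c : ℚ) (hc : c ≠ 0) :
    smith_selmerCorank_density (⟨0, -(3 * c), 0, 3 * c ^ 2, 0⟩ : WeierstrassCurve ℚ) :=
  haveI := isElliptic_jZero_twoTorsionNF c hc
  smith_selmerCorank_density_of_smi22a_printed h22 _
    (smi22aAssumption_of_smithCaseII _ (smithCaseII_jZero_twoTorsionNF c hc))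

/-- **Smith's law for every `y² = x³ + k`, `k ≠ 0`, from [Smi22a] Thm. 1.2.** If `k = c³` is a
rational cube, `y² = x³ + k ≅ y² = x(x² - 3cx + 3c²)` is in Case II (branch (2) of
Assumption 1.1); otherwise `x³ + k` has no rational root, `E(ℚ)[2] = 0` (branch (1),
`smith_selmerCorank_density_j_zero_model`). Either way no appeal to arXiv:2503.17619 is needed.
[cite: Smith2022SelmerTwistI, Thm. 1.2 with Assumption 1.1 (1), (2)]
[cite: SilvermanAEC2009, X.5 Prop. 5.4 (ii)] -/
theorem smith_selmerCorank_density_j_zero_model_of_smith2022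
    (h22 : smith2022_selmerCorank_distribution) {k : ℚ} (hk : k ≠ 0) :
    smith_selmerCorank_density (⟨0, 0, 0, 0, k⟩ : WeierstrassCurve ℚ) := by
  by_cases hcube : ∃ c : ℚ, k = c ^ 3
  · obtain ⟨c, rfl⟩ := hcube
    have hc : c ≠ 0 := by
      rintro rfl
      exact hk (by norm_num)
    have h := smith_selmerCorank_density_jZero_twoTorsionNF h22 c hc
    rw [← smul_j_zero_model_cube c] at h
    exact (smith_selmerCorank_density_smul_iff _ _).mp h
  · push Not at hcube
    exact smith_selmerCorank_density_j_zero_model h22 hk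
      fun x hx ↦ hcube (-x) (by linear_combination hx)

/-- **Smith's `1/2, 1/2, 0` law for EVERY elliptic curve over `ℚ` with `j = 0`** (CM by
`ℤ[ζ₃] ⊂ ℚ(√-3)`; the Mordell curves `y² = x³ + k` and all their models), from the refereed
[Smi22a] Thm. 1.2 alone. [cite: Smith2022SelmerTwistI, Thm. 1.2 with Assumption 1.1 (1), (2)]
[cite: SilvermanAEC2009, X.5 Prop. 5.4 (ii)] -/
theorem smith_selmerCorank_density_of_j_eq_zero_of_smith2022
    (h22 : smith2022_selmerCorank_distribution) (W : WeierstrassCurve ℚ) [W.IsElliptic]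
    (hj : W.j = 0) : smith_selmerCorank_density W := by
  obtain ⟨C, k, hk, hC⟩ := exists_variableChange_eq_j_zero_model W hj
  have h := smith_selmerCorank_density_j_zero_model_of_smith2022 h22 hk
  rw [← hC] at h
  exact (smith_selmerCorank_density_smul_iff W C).mp h

end JZero

/-! ## §2 `j = 54000`: the order `ℤ[√-3]` of conductor `2` -/

section J54000

/-- `y² = x(x² + 6dx - 3d²)` is elliptic for `d ≠ 0` (`a² - 4b = 48d²`, `b = -3d²`;
`Δ = 16b²(a² - 4b)`). [cite: SilvermanAEC2009, III.1 (formulas for `b₂, b₄, b₆, b₈, Δ`) and Prop. III.1.4 (a)] -/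
theorem isElliptic_twoTorsionNF_54000 (d : ℚ) (hd : d ≠ 0) :
    (⟨0, 6 * d, 0, -(3 * d ^ 2), 0⟩ : WeierstrassCurve ℚ).IsElliptic :=
  isElliptic_mk_of_ne (6 * d) (-(3 * d ^ 2))
    (by
      rw [show (6 * d) ^ 2 - 4 * (-(3 * d ^ 2)) = 48 * d ^ 2 by ring]
      exact mul_ne_zero (by norm_num) (pow_ne_zero 2 hd))
    (neg_ne_zero.mpr (mul_ne_zero three_ne_zero (pow_ne_zero 2 hd)))

/-- **`y² = x(x² + 6dx - 3d²)` (`d ≠ 0`; `j = 54000`) is in Smith's Case II**: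
`a² - 4b = 48d² = 3·(4d)²` with `3 ∉ ℚ²`, `b = -3d² < 0`, `b(a² - 4b) = -144d⁴ < 0` are
non-squares (`ℚ(E[2]) = ℚ(√3)`, `ℚ(E₀[2]) = ℚ(√-3)`).
[cite: Smith2026SelmerTwistII, §1 Example 1.2 and Thm. 1.4] [cite: SmithGoldfeld2025, Def. 1.6] -/
theorem smithCaseII_twoTorsionNF_54000 (d : ℚ) (hd : d ≠ 0) :
    smithCaseII (⟨0, 6 * d, 0, -(3 * d ^ 2), 0⟩ : WeierstrassCurve ℚ) := by
  have hd2 : 0 < d ^ 2 := by positivity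
  have h4 : (4 : ℚ) * d ≠ 0 := mul_ne_zero (by norm_num) hd
  refine smithCaseII_of_not_isSquare (6 * d) (-(3 * d ^ 2)) ?_ ?_ ?_
  · rintro ⟨r, hr⟩
    have h3 : IsSquare (3 : ℚ) := ⟨r / (4 * d), by
      rw [div_mul_div_comm, eq_div_iff (mul_ne_zero h4 h4)]
      linear_combination hr⟩
    norm_num at h3
  · rintro ⟨r, hr⟩
    nlinarith [mul_self_nonneg r]
  · rintro ⟨r, hr⟩
    nlinarith [mul_self_nonneg r, pow_pos hd2 2]

/-- **Smith's law for `y² = x(x² + 6dx - 3d²)`, `d ≠ 0`, from [Smi22a] Thm. 1.2.**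
[cite: Smith2022SelmerTwistI, Thm. 1.2 with Assumption 1.1 (2)] -/
theorem smith_selmerCorank_density_twoTorsionNF_54000 (h22 : smith2022_selmerCorank_distribution)
    (d : ℚ) (hd : d ≠ 0) :
    smith_selmerCorank_density (⟨0, 6 * d, 0, -(3 * d ^ 2), 0⟩ : WeierstrassCurve ℚ) :=
  haveI := isElliptic_twoTorsionNF_54000 d hd
  smith_selmerCorank_density_of_smi22a_printed h22 _
    (smi22aAssumption_of_smithCaseII _ (smithCaseII_twoTorsionNF_54000 d hd))

/-- The quadratic twist of `E₁₂ : y² = x³ + 6x² - 3x` (the tree's model of `j = 54000`,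
`ComplexMultiplicationMaximalOrderProofs`: `isElliptic_cm12`, `j_cm12`) by `d`, in the tree's
convention `E^{(d)} : y² = x³ + (d b₂/4)x² + (d² b₄/2)x + d³ b₆/4`, is `y² = x³ + 6d·x² - 3d²·x`
(`b₂ = 24`, `b₄ = -6`, `b₆ = 0`).
[cite: SilvermanAEC2009, X.5 Prop. 5.4 (i) and Cor. 5.4.1 (quadratic twists, `j ≠ 0, 1728`)] -/
theorem quadraticTwist_cm12 (d : ℚ) :
    (⟨0, 6, 0, -3, 0⟩ : WeierstrassCurve ℚ).quadraticTwist d = ⟨0, 6 * d, 0, -(3 * d ^ 2), 0⟩ := by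
  ext <;> simp only [quadraticTwist, WeierstrassCurve.b₂, WeierstrassCurve.b₄,
    WeierstrassCurve.b₆] <;> ring

/-- **Smith's `1/2, 1/2, 0` law for EVERY elliptic curve over `ℚ` with `j = 54000`** (CM by the
order `ℤ[√-3]`; e.g. the curves of conductor `36` which are `2`-isogenous to `y² = x³ + 1`), from
the refereed [Smi22a] Thm. 1.2 alone: such a curve is a model of a twist
`y² = x(x² + 6dx - 3d²)` of `E₁₂` (`j_cm12`), which is in Case II.
[cite: Smith2022SelmerTwistI, Thm. 1.2 with Assumption 1.1 (2)]
[cite: SilvermanAEC2009, X.5 Prop. 5.4] -/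
theorem smith_selmerCorank_density_of_j_eq_54000_of_smith2022
    (h22 : smith2022_selmerCorank_distribution) (W : WeierstrassCurve ℚ) [W.IsElliptic]
    (hj : W.j = 54000) : smith_selmerCorank_density W := by
  refine smith_selmerCorank_density_of_j_eq_of_forall_quadraticTwist
    (E := (⟨0, 6, 0, -3, 0⟩ : WeierstrassCurve ℚ))
    (by rw [j_cm12]; norm_num) (by rw [j_cm12]; norm_num)
    (fun d hd ↦ ?_) W (hj.trans j_cm12.symm)
  rw [quadraticTwist_cm12]
  exact smith_selmerCorank_density_twoTorsionNF_54000 h22 d hd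

end J54000

/-! ## §3 `j = 1728`: every `y² = x³ + Ax` -/

section J1728

/-- **Curves with `j = 1728` are `y² = x³ + Ax`, `A ≠ 0`, up to `ℚ`-isomorphism**: on a short
model `y² = x³ + a₄x + a₆`, `j = 1728` forces `c₄³ = 1728Δ`, i.e. `c₆ = -864a₆ = 0`
(`c₄³ - c₆² = 1728Δ`), and then `Δ = -64a₄³ ≠ 0` (Silverman, *AEC*, X.5.4(iii): the twists of
`j = 1728` are the `y² = x³ + Ax`, `A ∈ ℚ*/ℚ*⁴`). [cite: SilvermanAEC2009, X.5 Prop. 5.4 (iii)] -/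
theorem exists_variableChange_eq_j1728_model (W : WeierstrassCurve ℚ) [W.IsElliptic]
    (hj : W.j = 1728) : ∃ (C : VariableChange ℚ) (A : ℚ), A ≠ 0 ∧ C • W = ⟨0, 0, 0, A, 0⟩ := by
  haveI : Invertible (2 : ℚ) := invertibleOfNonzero two_ne_zero
  haveI : Invertible (3 : ℚ) := invertibleOfNonzero three_ne_zero
  obtain ⟨C, hC⟩ := W.exists_variableChange_isShortNF
  haveI := hC
  have hjS : (C • W).j = 1728 := by rw [variableChange_j]; exact hj
  have hΔ0 : (C • W).Δ ≠ 0 := by rw [← coe_Δ']; exact (C • W).Δ'.ne_zero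
  have hc4 : (C • W).c₄ ^ 3 = 1728 * (C • W).Δ := by
    have h := hjS
    rw [j, Units.val_inv_eq_inv_val, coe_Δ', inv_mul_eq_iff_eq_mul₀ hΔ0] at h
    linarith
  have hc6 : (C • W).c₆ = 0 := by
    have hrel := (C • W).c_relation
    have h : (C • W).c₆ ^ 2 = 0 := by linarith
    exact (pow_eq_zero_iff two_ne_zero).mp h
  have ha₆ : (C • W).a₆ = 0 := by
    have h := (C • W).c₆_of_isShortNF
    rw [hc6] at h
    linarith
  have ha₄ : (C • W).a₄ ≠ 0 := by
    intro h4
    apply hΔ0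
    rw [Δ_of_isShortNF, h4, ha₆]
    norm_num
  refine ⟨C, (C • W).a₄, ha₄, ?_⟩
  ext
  · exact a₁_of_isShortNF _
  · exact a₂_of_isShortNF _
  · exact a₃_of_isShortNF _
  · rfl
  · exact ha₆

/-- **`y² = x³ + Ax` with `A ∉ ℚ²` and `-A ∉ ℚ²` is in Smith's Case II**: `a² - 4b = -4A`,
`b = A`, `b(a² - 4b) = -4A² < 0` are non-squares, i.e. `E(ℚ)[2] ≅ ℤ/2ℤ` (`x² + A`
irreducible), `ℚ(E[2]) = ℚ(√-A) ≠ ℚ(√A) = ℚ(E₀[2])` (`E₀ : y² = x³ - 4Ax`) and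
`E₀(ℚ)[2] ≇ (ℤ/2ℤ)²` — [Smi22b] Thm. 1.4 with `K = ℚ(√-A)`, `K₀ = ℚ(√A)` distinct nontrivial
(e.g. `y² = x³ - 2x`, `y² = x³ + 3x`).
[cite: Smith2026SelmerTwistII, §1 Example 1.2 and Thm. 1.4] [cite: SmithGoldfeld2025, Def. 1.6] -/
theorem smithCaseII_j1728_model {A : ℚ} (h₁ : ¬ IsSquare A) (h₂ : ¬ IsSquare (-A)) :
    smithCaseII (⟨0, 0, 0, A, 0⟩ : WeierstrassCurve ℚ) := by
  have hA : A ≠ 0 := by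
    rintro rfl
    exact h₁ ⟨0, by norm_num⟩
  have hA2 : 0 < A ^ 2 := by positivity
  refine smithCaseII_of_not_isSquare 0 A ?_ h₁ ?_
  · rintro ⟨r, hr⟩
    exact h₂ ⟨r / 2, by linear_combination (1 / 4 : ℚ) * hr⟩
  · rintro ⟨r, hr⟩
    nlinarith [mul_self_nonneg r]

/-- **`y² = x³ - c²x = x(x - c)(x + c)`, `c ≠ 0` (the congruent number twists), is in Smith's
Case I**: `E(ℚ)[2] ≅ (ℤ/2ℤ)²` and no balanced isogeny, by `smithCaseI_iff_of_roots` with roots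
`r = c`, `s = -c`: `rs = -c² < 0`, `r(r - s) = s(s - r) = 2c²` with `2 ∉ ℚ²` are non-squares —
equivalently `E` has no rational cyclic `4`-isogeny ([Smi22a] Assumption 1.1 (3); this is the
hypothesis check behind Burungale–Tian, Ann. of Math. 203 (2026), Thm. 3.3 = Smith's theorem for
`y² = x³ - x`). [cite: SmithGoldfeld2025, Def. 1.6] [cite: Smith2022SelmerTwistI, Assumption 1.1 (3)]
[cite: BurungaleTian2026, Thm. 3.3] -/
theorem smithCaseI_j1728_model_neg_sq (c : ℚ) (hc : c ≠ 0) :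
    smithCaseI (⟨0, 0, 0, -c ^ 2, 0⟩ : WeierstrassCurve ℚ) := by
  haveI : (⟨0, 0, 0, -c ^ 2, 0⟩ : WeierstrassCurve ℚ).IsElliptic :=
    isElliptic_mk_of_ne 0 (-c ^ 2)
      (by
        rw [show (0 : ℚ) ^ 2 - 4 * (-c ^ 2) = -4 * (-c ^ 2) by ring]
        exact mul_ne_zero (by norm_num) (neg_ne_zero.mpr (pow_ne_zero 2 hc)))
      (neg_ne_zero.mpr (pow_ne_zero 2 hc))
  have hc2 : 0 < c ^ 2 := by positivity
  refine (smithCaseI_iff_of_roots (r := c) (s := -c) (⟨0, 0, 0, -c ^ 2, 0⟩ : WeierstrassCurve ℚ)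
    (by show (0 : ℚ) = -(c + -c); ring) (by show -c ^ 2 = c * -c; ring)).mpr ⟨?_, ?_, ?_⟩
  · rintro ⟨r, hr⟩
    nlinarith [mul_self_nonneg r]
  · rintro ⟨r, hr⟩
    have h2 : IsSquare (2 : ℚ) := ⟨r / c, by
      rw [div_mul_div_comm, eq_div_iff (mul_ne_zero hc hc)]
      linear_combination hr⟩
    norm_num at h2
  · rintro ⟨r, hr⟩
    have h2 : IsSquare (2 : ℚ) := ⟨r / c, by
      rw [div_mul_div_comm, eq_div_iff (mul_ne_zero hc hc)]
      linear_combination hr⟩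
    norm_num at h2

/-- **Smith's law for `y² = x³ + c²x`, `c ≠ 0` (Case III), from [Smi22a] Thm. 1.2**: it is
`2`-isogenous to `Y² = X³ - 4c²X = X(X - 2c)(X + 2c)`, which is in Case I, and Smith's theorem
is an isogeny invariant (arXiv:2503.17619 §1.1: "Since we have `r_{2^∞}(E^d) = r_{2^∞}(E₀^d)`
for all nonzero integers `d`, Theorem 1.1 will follow for `E` since it holds for `E₀`"; tree
`smith_selmerCorank_density_of_isogeny`).
[cite: Smith2022SelmerTwistI, Thm. 1.2 with Assumption 1.1 (3)]
[cite: SmithGoldfeld2025, §1.1 (Case III reduction, after Thm. 1.7)] -/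
theorem smith_selmerCorank_density_j1728_model_sq (h22 : smith2022_selmerCorank_distribution)
    (c : ℚ) (hc : c ≠ 0) :
    smith_selmerCorank_density (⟨0, 0, 0, c ^ 2, 0⟩ : WeierstrassCurve ℚ) := by
  haveI : (⟨0, 0, 0, c ^ 2, 0⟩ : WeierstrassCurve ℚ).IsElliptic :=
    isElliptic_mk_of_ne 0 (c ^ 2)
      (by
        rw [show (0 : ℚ) ^ 2 - 4 * (c ^ 2) = -4 * (c ^ 2) by ring]
        exact mul_ne_zero (by norm_num) (pow_ne_zero 2 hc))
      (pow_ne_zero 2 hc)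
  have h2c : (2 : ℚ) * c ≠ 0 := mul_ne_zero two_ne_zero hc
  haveI : (⟨0, 0, 0, -(2 * c) ^ 2, 0⟩ : WeierstrassCurve ℚ).IsElliptic :=
    isElliptic_mk_of_ne 0 (-(2 * c) ^ 2)
      (by
        rw [show (0 : ℚ) ^ 2 - 4 * (-(2 * c) ^ 2) = -4 * (-(2 * c) ^ 2) by ring]
        exact mul_ne_zero (by norm_num) (neg_ne_zero.mpr (pow_ne_zero 2 h2c)))
      (neg_ne_zero.mpr (pow_ne_zero 2 h2c))
  have h₀ : smith_selmerCorank_density (⟨0, 0, 0, -(2 * c) ^ 2, 0⟩ : WeierstrassCurve ℚ) :=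
    smith_selmerCorank_density_of_smi22a_printed h22 _
      (smi22aAssumption_of_smithCaseI _ (smithCaseI_j1728_model_neg_sq (2 * c) h2c))
  have e : (⟨0, 0, 0, c ^ 2, 0⟩ : WeierstrassCurve ℚ).twoIsogenyCodomain =
      ⟨0, 0, 0, -(2 * c) ^ 2, 0⟩ := by
    rw [twoIsogenyCodomain_mk]
    congr 1 <;> ring
  exact smith_selmerCorank_density_of_isogeny (⟨0, 0, 0, c ^ 2, 0⟩ : WeierstrassCurve ℚ).twoIsogeny
    (by rw [e]; exact h₀)

/-- **Smith's law for every `y² = x³ + Ax`, `A ≠ 0`, from [Smi22a] Thm. 1.2**: `-A ∈ ℚ²`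
(Case I, the congruent number twists), `A ∈ ℚ²` (Case III, via the `2`-isogenous Case I curve),
or neither (Case II). [cite: Smith2022SelmerTwistI, Thm. 1.2 with Assumption 1.1]
[cite: SmithGoldfeld2025, §1.1 (Cases I, II from [Smi22a]; Case III reduction)] -/
theorem smith_selmerCorank_density_j1728_model_of_smith2022
    (h22 : smith2022_selmerCorank_distribution) {A : ℚ} (hA : A ≠ 0) :
    smith_selmerCorank_density (⟨0, 0, 0, A, 0⟩ : WeierstrassCurve ℚ) := by
  by_cases h₁ : IsSquare (-A)
  · obtain ⟨c, hc⟩ := h₁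
    have hc0 : c ≠ 0 := by
      rintro rfl
      apply hA
      linarith
    have e : A = -c ^ 2 := by linear_combination -hc
    rw [e]
    haveI : (⟨0, 0, 0, -c ^ 2, 0⟩ : WeierstrassCurve ℚ).IsElliptic :=
      isElliptic_mk_of_ne 0 (-c ^ 2)
        (by
          rw [show (0 : ℚ) ^ 2 - 4 * (-c ^ 2) = -4 * (-c ^ 2) by ring]
          exact mul_ne_zero (by norm_num) (neg_ne_zero.mpr (pow_ne_zero 2 hc0)))
        (neg_ne_zero.mpr (pow_ne_zero 2 hc0))
    exact smith_selmerCorank_density_of_smi22a_printed h22 _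
      (smi22aAssumption_of_smithCaseI _ (smithCaseI_j1728_model_neg_sq c hc0))
  · by_cases h₂ : IsSquare A
    · obtain ⟨c, hc⟩ := h₂
      have hc0 : c ≠ 0 := by
        rintro rfl
        apply hA
        linarith
      have e : A = c ^ 2 := by linear_combination hc
      rw [e]
      exact smith_selmerCorank_density_j1728_model_sq h22 c hc0
    · haveI : (⟨0, 0, 0, A, 0⟩ : WeierstrassCurve ℚ).IsElliptic :=
        isElliptic_mk_of_ne 0 (A)
          (by
            rw [show (0 : ℚ) ^ 2 - 4 * (A) = -4 * (A) by ring]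
            exact mul_ne_zero (by norm_num) (hA))
          (hA)
      exact smith_selmerCorank_density_of_smi22a_printed h22 _
        (smi22aAssumption_of_smithCaseII _ (smithCaseII_j1728_model h₂ h₁))

/-- **Smith's `1/2, 1/2, 0` law for EVERY elliptic curve over `ℚ` with `j = 1728`** (CM by
`ℤ[i]`: the curves `y² = x³ + Ax` and all their models, including the congruent number family),
from the refereed [Smi22a] Thm. 1.2 alone (Cases I, II directly; Case III through the isogenous
Case I curve). [cite: Smith2022SelmerTwistI, Thm. 1.2 with Assumption 1.1]
[cite: SilvermanAEC2009, X.5 Prop. 5.4 (iii)] -/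
theorem smith_selmerCorank_density_of_j_eq_1728_of_smith2022
    (h22 : smith2022_selmerCorank_distribution) (W : WeierstrassCurve ℚ) [W.IsElliptic]
    (hj : W.j = 1728) : smith_selmerCorank_density W := by
  obtain ⟨C, A, hA, hC⟩ := exists_variableChange_eq_j1728_model W hj
  have h := smith_selmerCorank_density_j1728_model_of_smith2022 h22 hA
  rw [← hC] at h
  exact (smith_selmerCorank_density_smul_iff W C).mp h

end J1728

/-! ## §4 `j = 287496`: the order `ℤ[2i]` of conductor `2` -/

section J287496

/-- **`Y² = X(X + 4d)(X + 8d)`, `d ≠ 0` (a twist of `y² = x³ - x`, `j = 1728`), is in Smith's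
Case I**: roots `r = -4d`, `s = -8d` give `rs = 32d² = 2(4d)²`, `r(r - s) = -16d² < 0`,
`s(s - r) = 32d²`, all non-squares (`2 ∉ ℚ²`). [cite: SmithGoldfeld2025, Def. 1.6]
[cite: Smith2022SelmerTwistI, Assumption 1.1 (3)] -/
theorem smithCaseI_cm16Twist_codomain (d : ℚ) (hd : d ≠ 0) :
    smithCaseI (⟨0, 12 * d, 0, 32 * d ^ 2, 0⟩ : WeierstrassCurve ℚ) := by
  haveI := isElliptic_mk_of_ne (12 * d) (32 * d ^ 2)
    (by
      rw [show (12 * d) ^ 2 - 4 * (32 * d ^ 2) = 16 * d ^ 2 by ring]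
      exact mul_ne_zero (by norm_num) (pow_ne_zero 2 hd))
    (mul_ne_zero (by norm_num) (pow_ne_zero 2 hd))
  have hd2 : 0 < d ^ 2 := by positivity
  have h4 : (4 : ℚ) * d ≠ 0 := mul_ne_zero (by norm_num) hd
  refine (smithCaseI_iff_of_roots (r := -(4 * d)) (s := -(8 * d))
    (⟨0, 12 * d, 0, 32 * d ^ 2, 0⟩ : WeierstrassCurve ℚ)
    (by show 12 * d = -(-(4 * d) + -(8 * d)); ring)
    (by show 32 * d ^ 2 = -(4 * d) * -(8 * d); ring)).mpr ⟨?_, ?_, ?_⟩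
  · rintro ⟨r, hr⟩
    have h2 : IsSquare (2 : ℚ) := ⟨r / (4 * d), by
      rw [div_mul_div_comm, eq_div_iff (mul_ne_zero h4 h4)]
      linear_combination hr⟩
    norm_num at h2
  · rintro ⟨r, hr⟩
    nlinarith [mul_self_nonneg r]
  · rintro ⟨r, hr⟩
    have h2 : IsSquare (2 : ℚ) := ⟨r / (4 * d), by
      rw [div_mul_div_comm, eq_div_iff (mul_ne_zero h4 h4)]
      linear_combination hr⟩
    norm_num at h2

/-- **`y² = x(x² - 6dx + d²)` (`d ≠ 0`; `j = 287496`) is in Smith's Case III, and Smith's law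
for it follows from [Smi22a] Thm. 1.2** via the `2`-isogenous Case I curve
`Y² = X³ + 12dX² + 32d²X = X(X + 4d)(X + 8d)` (`b = d²` is a square, so `E₀(ℚ)[2] ≅ (ℤ/2ℤ)²`)
and isogeny invariance (arXiv:2503.17619 §1.1; tree `smith_selmerCorank_density_of_isogeny`).
[cite: Smith2022SelmerTwistI, Thm. 1.2 with Assumption 1.1 (3)]
[cite: SmithGoldfeld2025, §1.1 (Case III reduction, after Thm. 1.7)] -/
theorem smith_selmerCorank_density_cm16Twist (h22 : smith2022_selmerCorank_distribution)
    (d : ℚ) (hd : d ≠ 0) :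
    smith_selmerCorank_density (⟨0, -(6 * d), 0, d ^ 2, 0⟩ : WeierstrassCurve ℚ) := by
  haveI := isElliptic_mk_of_ne (-(6 * d)) (d ^ 2)
    (by
      rw [show (-(6 * d)) ^ 2 - 4 * d ^ 2 = 32 * d ^ 2 by ring]
      exact mul_ne_zero (by norm_num) (pow_ne_zero 2 hd))
    (pow_ne_zero 2 hd)
  haveI := isElliptic_mk_of_ne (12 * d) (32 * d ^ 2)
    (by
      rw [show (12 * d) ^ 2 - 4 * (32 * d ^ 2) = 16 * d ^ 2 by ring]
      exact mul_ne_zero (by norm_num) (pow_ne_zero 2 hd))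
    (mul_ne_zero (by norm_num) (pow_ne_zero 2 hd))
  have h₀ : smith_selmerCorank_density (⟨0, 12 * d, 0, 32 * d ^ 2, 0⟩ : WeierstrassCurve ℚ) :=
    smith_selmerCorank_density_of_smi22a_printed h22 _
      (smi22aAssumption_of_smithCaseI _ (smithCaseI_cm16Twist_codomain d hd))
  have e : (⟨0, -(6 * d), 0, d ^ 2, 0⟩ : WeierstrassCurve ℚ).twoIsogenyCodomain =
      ⟨0, 12 * d, 0, 32 * d ^ 2, 0⟩ := by
    rw [twoIsogenyCodomain_mk]
    congr 1 <;> ring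
  exact smith_selmerCorank_density_of_isogeny
    (⟨0, -(6 * d), 0, d ^ 2, 0⟩ : WeierstrassCurve ℚ).twoIsogeny (by rw [e]; exact h₀)

/-- The quadratic twist of `E₁₆ : y² = x³ - 6x² + x` (the tree's model of `j = 287496`,
`isElliptic_cm16`, `j_cm16`) by `d` (tree convention `y² = x³ + (d b₂/4)x² + (d² b₄/2)x + d³ b₆/4`)
is `y² = x³ - 6d·x² + d²·x` (`b₂ = -24`, `b₄ = 2`, `b₆ = 0`).
[cite: SilvermanAEC2009, X.5 Prop. 5.4 (i) and Cor. 5.4.1 (quadratic twists, `j ≠ 0, 1728`)] -/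
theorem quadraticTwist_cm16 (d : ℚ) :
    (⟨0, -6, 0, 1, 0⟩ : WeierstrassCurve ℚ).quadraticTwist d = ⟨0, -(6 * d), 0, d ^ 2, 0⟩ := by
  ext <;> simp only [quadraticTwist, WeierstrassCurve.b₂, WeierstrassCurve.b₄,
    WeierstrassCurve.b₆] <;> ring

/-- **Smith's `1/2, 1/2, 0` law for EVERY elliptic curve over `ℚ` with `j = 287496 = 66³`**
(CM by the order `ℤ[2i]`; e.g. `y² = x³ - 11x ± 14` of conductor `32`), from the refereed
[Smi22a] Thm. 1.2 alone (these curves are in Case III; Smith's law is transported from the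
`2`-isogenous congruent-number twists, Case I). This is the "routine check not formalised" for
`ℤ[2i]` in `Kriz2020/GoldfeldJ1728Proofs`. [cite: Smith2022SelmerTwistI, Thm. 1.2 with Assumption 1.1 (3)]
[cite: SmithGoldfeld2025, §1.1 (Case III reduction)] [cite: SilvermanAEC2009, X.5 Prop. 5.4] -/
theorem smith_selmerCorank_density_of_j_eq_287496_of_smith2022
    (h22 : smith2022_selmerCorank_distribution) (W : WeierstrassCurve ℚ) [W.IsElliptic]
    (hj : W.j = 287496) : smith_selmerCorank_density W := by
  refine smith_selmerCorank_density_of_j_eq_of_forall_quadraticTwist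
    (E := (⟨0, -6, 0, 1, 0⟩ : WeierstrassCurve ℚ))
    (by rw [j_cm16]; norm_num) (by rw [j_cm16]; norm_num)
    (fun d hd ↦ ?_) W (hj.trans j_cm16.symm)
  rw [quadraticTwist_cm16]
  exact smith_selmerCorank_density_cm16Twist h22 d hd

end J287496

/-! ## §5 `j = 8000`: [Smi22a] Assumption 1.1 fails (balanced `2`-isogeny, Cases IV/V) -/

section J8000

/-- `y² = x(x² + 4dx + 2d²)` is elliptic for `d ≠ 0` (`a² - 4b = 8d²`, `b = 2d²`;
`Δ = 16b²(a² - 4b)`). [cite: SilvermanAEC2009, III.1 (formulas for `b₂, b₄, b₆, b₈, Δ`) and Prop. III.1.4 (a)] -/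
theorem isElliptic_twoTorsionNF_8000 (d : ℚ) (hd : d ≠ 0) :
    (⟨0, 4 * d, 0, 2 * d ^ 2, 0⟩ : WeierstrassCurve ℚ).IsElliptic :=
  isElliptic_mk_of_ne (4 * d) (2 * d ^ 2)
    (by
      rw [show (4 * d) ^ 2 - 4 * (2 * d ^ 2) = 8 * d ^ 2 by ring]
      exact mul_ne_zero (by norm_num) (pow_ne_zero 2 hd))
    (mul_ne_zero two_ne_zero (pow_ne_zero 2 hd))

/-- **`y² = x(x² + 4dx + 2d²)` (`d ≠ 0`; `j = 8000`) is NOT in Smith's Case II**: here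
`b(a² - 4b) = 2d²·8d² = (4d²)²` IS a square, i.e. `ℚ(E[2]) = ℚ(√(8d²)) = ℚ(√2) = ℚ(√(2d²)) = ℚ(E₀[2])`
— the `2`-isogeny `E → E₀` is balanced (arXiv:2503.17619, Def. 1.6), against the standing
hypothesis "`K` and `K₀` distinct" of [Smi22b] Thm. 1.4 (`smithCaseII_iff_not_isSquare`).
[cite: SmithGoldfeld2025, Def. 1.6] [cite: Smith2026SelmerTwistII, §1 Thm. 1.4] -/
theorem not_smithCaseII_twoTorsionNF_8000 (d : ℚ) (hd : d ≠ 0) :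
    ¬ smithCaseII (⟨0, 4 * d, 0, 2 * d ^ 2, 0⟩ : WeierstrassCurve ℚ) := by
  haveI := isElliptic_twoTorsionNF_8000 d hd
  intro h
  exact (not_isSquare_of_smithCaseII (4 * d) (2 * d ^ 2) h).2.2 ⟨4 * d ^ 2, by ring⟩

/-- `y² = x(x² + 4dx + 2d²)` (`d ≠ 0`) has `E(ℚ)[2] ≅ ℤ/2ℤ`: not trivial (the kernel `⟨(0,0)⟩` of
the `2`-isogeny), not `(ℤ/2ℤ)²` (`x² + 4dx + 2d²` has discriminant `8d² ∉ ℚ²`).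
[cite: SilvermanAEC2009, X.4.9] -/
theorem ratTwoTorsionCard_twoTorsionNF_8000 (d : ℚ) (hd : d ≠ 0) :
    ratTwoTorsionCard (⟨0, 4 * d, 0, 2 * d ^ 2, 0⟩ : WeierstrassCurve ℚ) = 2 := by
  haveI := isElliptic_twoTorsionNF_8000 d hd
  have h2d : (2 : ℚ) * d ≠ 0 := mul_ne_zero two_ne_zero hd
  have hdeg : ((⟨0, 4 * d, 0, 2 * d ^ 2, 0⟩ : WeierstrassCurve ℚ).twoIsogeny).degree = 2 :=
    degree_twoIsogeny _
  rcases ratTwoTorsionCard_eq_one_or_two_or_four (⟨0, 4 * d, 0, 2 * d ^ 2, 0⟩ : WeierstrassCurve ℚ)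
    with h | h | h4
  · exact absurd h (Isogeny.ratTwoTorsionCard_ne_one_of_degree_eq_two _ _ hdeg)
  · exact h
  · exfalso
    obtain ⟨α, β, hα, hβ⟩ := exists_roots_of_ker_galoisRepTorsion_two_eq_top _ two_ne_zero
      (ker_galoisRepTorsion_two_eq_top_of_ratTwoTorsionCard_eq_four _ h4)
    have hα' : (4 : ℚ) * d = -(α + β) := hα
    have hβ' : (2 : ℚ) * d ^ 2 = α * β := hβ
    have h8 : IsSquare (2 : ℚ) := ⟨(α - β) / (2 * d), by
      rw [div_mul_div_comm, eq_div_iff (mul_ne_zero h2d h2d)]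
      linear_combination (4 * d - (α + β)) * hα' - 4 * hβ'⟩
    norm_num at h8

/-- **[Smi22a] Assumption 1.1 fails for `y² = x(x² + 4dx + 2d²)`, `d ≠ 0`**: not Case I
(`#E(ℚ)[2] = 2`) and not Case II (balanced `2`-isogeny), while Assumption 1.1 ⟺ Case I ∨ Case II
(`smi22aAssumption_iff_smithCaseI_or_smithCaseII`). These curves are in Smith's Cases IV/V, for
which arXiv:2503.17619 says: "The main goal of this paper is to establish this theorem for
Cases IV and V" (Thm. 1.7). [cite: Smith2022SelmerTwistI, Assumption 1.1]
[cite: SmithGoldfeld2025, §1.1 (Def. 1.6 and Thm. 1.7)] -/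
theorem not_smi22aAssumption_twoTorsionNF_8000 (d : ℚ) (hd : d ≠ 0) :
    ¬ smi22aAssumption (⟨0, 4 * d, 0, 2 * d ^ 2, 0⟩ : WeierstrassCurve ℚ) := by
  haveI := isElliptic_twoTorsionNF_8000 d hd
  intro h
  rcases smithCaseI_or_smithCaseII_of_smi22aAssumption _ h with (h1 | ⟨h4, -⟩) | hII
  · rw [ratTwoTorsionCard_twoTorsionNF_8000 d hd] at h1
    exact absurd h1 (by decide)
  · rw [ratTwoTorsionCard_twoTorsionNF_8000 d hd] at h4
    exact absurd h4 (by decide)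
  · exact not_smithCaseII_twoTorsionNF_8000 d hd hII

/-- The quadratic twist of `E₈ = cm8 : y² = x³ + 4x² + 2x` (`ComplexMultiplicationTwistIsogenyProofs`:
`isElliptic_cm8`, `j_cm8 = 8000`) by `d` (tree convention
`y² = x³ + (d b₂/4)x² + (d² b₄/2)x + d³ b₆/4`) is `y² = x³ + 4d·x² + 2d²·x` (`b₂ = 16`, `b₄ = 4`,
`b₆ = 0`). [cite: SilvermanAEC2009, X.5 Prop. 5.4 (i) and Cor. 5.4.1 (quadratic twists, `j ≠ 0, 1728`)] -/
theorem quadraticTwist_cm8 (d : ℚ) : cm8.quadraticTwist d = ⟨0, 4 * d, 0, 2 * d ^ 2, 0⟩ := by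
  ext <;> simp only [quadraticTwist, WeierstrassCurve.b₂, WeierstrassCurve.b₄,
    WeierstrassCurve.b₆] <;> ring

/-- **[Smi22a] does not apply to ANY elliptic curve over `ℚ` with `j = 8000`** (CM by
`ℤ[√-2]`): such a curve is a model `C • W = E₈^{(d)}` of a twist `y² = x(x² + 4dx + 2d²)`
(Silverman X.5.4), Assumption 1.1 fails for that model, and it would transport from `W` to
`C • W` (`#E(ℚ)[2]` by `ratTwoTorsionCard_smul`, Case II by `smithCaseII_smul`). For the
`j = 8000` twist families the tree's Smith input is therefore the assembly
`smith_selmerCorank_density_holds_of` (arXiv:2503.17619 Thm. 1.17 for Cases IV/V + Monsky +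
Modularity), not the refereed [Smi22a]. [cite: Smith2022SelmerTwistI, Assumption 1.1]
[cite: SmithGoldfeld2025, §1.1 (Def. 1.6, Thm. 1.7)] [cite: SilvermanAEC2009, X.5 Prop. 5.4] -/
theorem not_smi22aAssumption_of_j_eq_8000 (W : WeierstrassCurve ℚ) [W.IsElliptic]
    (hj : W.j = 8000) : ¬ smi22aAssumption W := by
  obtain ⟨d, hd, C, hC⟩ := exists_variableChange_eq_quadraticTwist_of_j_eq' (W := W)
    (E := cm8) (hj.trans j_cm8.symm) (by rw [hj]; norm_num) (by rw [hj]; norm_num)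
  rw [quadraticTwist_cm8] at hC
  haveI := isElliptic_twoTorsionNF_8000 d hd
  intro h
  rcases smithCaseI_or_smithCaseII_of_smi22aAssumption W h with (h1 | ⟨h4, -⟩) | hII
  · have h1' := (ratTwoTorsionCard_smul W C).trans h1
    rw [hC, ratTwoTorsionCard_twoTorsionNF_8000 d hd] at h1'
    exact absurd h1' (by decide)
  · have h4' := (ratTwoTorsionCard_smul W C).trans h4
    rw [hC, ratTwoTorsionCard_twoTorsionNF_8000 d hd] at h4'
    exact absurd h4' (by decide)
  · have hII' := smithCaseII_smul C hII
    rw [hC] at hII'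
    exact not_smithCaseII_twoTorsionNF_8000 d hd hII'

end J8000

end Literature.NumberTheory.EllipticCurves

end
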